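import Mathlib
import Summits.BirchSwinnertonDyer.BirchSwinnertonDyer.Theorems.KatoDescentTamePotSupersingularTameLowerFibreAdjointBricksFive

/-!
# Bricks for the `GL₂(𝔽₅)`-lifting route (T5′), II: Teichmüller rigidity and the non-splitting of
# `S^μ(ℤ/5^{m+1}) → S^μ(ℤ/5^m)` for every `m ≥ 1`

Continuation of `…TameLowerFibreAdjointBricksFive` (same namespace). ARM-P audit r07 S7 ADDENDUM-1
§C (C3)(e) runs Manoharmayum's Claim 4.3 with the finite group `Q = S^μ(W_m) = {g ∈ GL₂(ℤ/5^m) :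
det g ∈ μ₄}` in place of `SL₂(W_m)` and needs the extension
`0 → M₀(𝔽₅) → S^μ(W_{m+1}) → S^μ(W_m) → 1` to be NON-split; the printed reduction to the `SL₂`
case uses `μ₄ ∩ (1 + 5·ℤ/5^{m+1}) = {1}`. Both steps are kernel-checked here, without introducing a
definition of `S^μ` (pure proof file):

* `exists_eq_mul_of_cast_eq_zero` — the kernel of `ℤ/n → ℤ/d` (`d ∣ n`) is `d·ℤ/n`;
* `eq_one_of_pow_four_eq_one` — in `ℤ/5^{m+1}`: `x ≡ 1 (mod 5)` and `x⁴ = 1` imply `x = 1`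
  (the principal units are a `5`-group: `(1 + 5y)⁴ = 1` gives `5y·(1 − 5t) = 0` with `1 − 5t` a
  unit by the geometric series, `(5t)^{m+1} = 0`);
* `not_exists_section_detPowFour` — for every `m ≥ 1` there is NO homomorphism
  `SL₂(ℤ/5^m) → GL₂(ℤ/5^{m+1})` lifting the inclusion entrywise whose determinants satisfy
  `det⁴ = 1` (i.e. with values in `S^μ`); by rigidity such a map has `det = 1` and would be a
  section of `SL₂(ℤ/5^{m+1}) → SL₂(ℤ/5^m)`, excluded by `not_exists_section_SL2` (file I);
* `exists_eq_smul_of_commute_transvections` — **Schur for `𝔰𝔩₂`** over any field with `2 ≠ 0`: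
  a linear endomorphism of `M₂(F)` preserving trace zero and commuting on `𝔰𝔩₂` with `Ad(u)`,
  `Ad(v)` acts on `𝔰𝔩₂` as a scalar (`End_{SL₂}(𝔰𝔩₂) = F`, absolute irreducibility) — the
  input of the `(5, 𝔽₅)` case of [M] Prop. 3.6 (file III `…AdjointBricksFiveInflation`).

As file I: Mathlib + file I only, route-free, nothing about elliptic curves, nothing proved about
items 19618/19981 (Kato's Conj. 12.10 lower inclusion at an additive potentially supersingular
prime — open); target T-S7r07-1 (`FibreLatticeInput 5`, Δ1 at `p = 5` on the cite-level facts
`Fouquet2024.padicValRat_bsd_rank_zero_of_ordinaryFibre{_ellipticShape,}{,_levelNotOneModP}`).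
[M] = Manoharmayum, Proc. AMS 143 (2015), arXiv:1304.1196, Props. 3.7, 4.2, Claim 4.3.
-/

set_option linter.dupNamespace false

open Matrix

namespace Summit.BirchSwinnertonDyer.BirchSwinnertonDyer.Theorems.GL2F5AdjointBricks

/-- In `ℤ/n`, an element reducing to `0` in `ℤ/d` (`d ∣ n`) is a multiple of `d`. -/
theorem exists_eq_mul_of_cast_eq_zero {n d : ℕ} [NeZero n] (h : d ∣ n) (x : ZMod n)
    (hx : ZMod.castHom h (ZMod d) x = 0) : ∃ t : ZMod n, x = (d : ZMod n) * t := by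
  have hval : ((x.val : ℕ) : ZMod d) = 0 := by
    rwa [ZMod.castHom_apply, ZMod.cast_eq_val] at hx
  obtain ⟨q, hq⟩ := (ZMod.natCast_eq_zero_iff _ _).1 hval
  refine ⟨q, ?_⟩
  rw [← ZMod.natCast_zmod_val x, hq]
  push_cast
  ring

/-- **Teichmüller rigidity in `ℤ/5^{m+1}`**: an element `≡ 1 (mod 5)` with `x⁴ = 1` is `1`
(`μ₄ ∩ (1 + 5ℤ/5^{m+1}) = {1}`: the principal units form a `5`-group). Input of (C3)(b),(e). -/
theorem eq_one_of_pow_four_eq_one (m : ℕ) (x : ZMod (5 ^ (m + 1)))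
    (h1 : ZMod.castHom (dvd_pow_self 5 (Nat.succ_ne_zero m)) (ZMod 5) x = 1) (h4 : x ^ 4 = 1) :
    x = 1 := by
  haveI : NeZero (5 ^ (m + 1)) := ⟨pow_ne_zero _ (by norm_num)⟩
  have h0 : (5 : ZMod (5 ^ (m + 1))) ^ (m + 1) = 0 := by
    exact_mod_cast ZMod.natCast_self (5 ^ (m + 1))
  -- `x = 1 + 5y`
  have hx0 : ZMod.castHom (dvd_pow_self 5 (Nat.succ_ne_zero m)) (ZMod 5) (x - 1) = 0 := by
    rw [map_sub, h1, map_one, sub_self]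
  obtain ⟨y, hy⟩ := exists_eq_mul_of_cast_eq_zero _ (x - 1) hx0
  rw [sub_eq_iff_eq_add] at hy
  push_cast at hy
  -- `(1 + 5y)^4 = 1` gives `5y · (1 - 5t) = 0` with `t = 1 + 6y + 20y² + 25y³`
  have key : (5 : ZMod (5 ^ (m + 1))) * y * (1 - 5 * (1 + 6 * y + 20 * y ^ 2 + 25 * y ^ 3)) = 0 := by
    have h := h4
    rw [hy] at h
    linear_combination (-1 : ZMod (5 ^ (m + 1))) * h
  -- `1 - 5t` is a unit: `(1 - 5t) · Σ_{i ≤ m} (5t)^i = 1 - (5t)^{m+1} = 1`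
  set t : ZMod (5 ^ (m + 1)) := 1 + 6 * y + 20 * y ^ 2 + 25 * y ^ 3 with ht
  have hunit : (1 - 5 * t) * (∑ i ∈ Finset.range (m + 1), (5 * t) ^ i) = 1 := by
    rw [mul_neg_geom_sum, mul_pow, h0, zero_mul, sub_zero]
  have h5y : (5 : ZMod (5 ^ (m + 1))) * y = 0 := by
    have := congrArg (· * ∑ i ∈ Finset.range (m + 1), (5 * t) ^ i) key
    simpa [mul_assoc, hunit] using this
  rw [hy]
  linear_combination h5y

/-- **Non-splitting for `Q = S^μ` ((C3)(e)).** For every `m ≥ 1` there is no homomorphism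
`s : SL₂(ℤ/5^m) → GL₂(ℤ/5^{m+1})` lifting the inclusion (entrywise reduction of `s g` is `g`) whose
determinants are fourth roots of unity (`det (s g)⁴ = 1`, i.e. values in
`S^μ(ℤ/5^{m+1}) = {det ∈ μ₄}`): by `eq_one_of_pow_four_eq_one` such an `s` has `det = 1`, i.e. is a
section of `SL₂(ℤ/5^{m+1}) → SL₂(ℤ/5^m)`, excluded by `not_exists_section_SL2`. -/
theorem not_exists_section_detPowFour (m : ℕ) (hm : 1 ≤ m) :
    ¬ ∃ s : Matrix.SpecialLinearGroup (Fin 2) (ZMod (5 ^ m)) →* GL (Fin 2) (ZMod (5 ^ (m + 1))),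
      (∀ g, Matrix.det ((s g : GL (Fin 2) (ZMod (5 ^ (m + 1)))) : Matrix (Fin 2) (Fin 2) (ZMod (5 ^ (m + 1)))) ^ 4 = 1) ∧
      ∀ g, (ZMod.castHom (pow_dvd_pow 5 m.le_succ) (ZMod (5 ^ m))).mapMatrix
          ((s g : GL (Fin 2) (ZMod (5 ^ (m + 1)))) : Matrix (Fin 2) (Fin 2) (ZMod (5 ^ (m + 1)))) =
        (g : Matrix (Fin 2) (Fin 2) (ZMod (5 ^ m))) := by
  rintro ⟨s, hdet4, hred⟩
  haveI : NeZero (5 ^ (m + 1)) := ⟨pow_ne_zero _ (by norm_num)⟩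
  haveI : NeZero (5 ^ m) := ⟨pow_ne_zero _ (by norm_num)⟩
  set f := ZMod.castHom (pow_dvd_pow 5 m.le_succ) (ZMod (5 ^ m)) with hf
  -- determinants are `1`
  have hdet : ∀ g, Matrix.det ((s g : GL (Fin 2) (ZMod (5 ^ (m + 1)))) : Matrix (Fin 2) (Fin 2) (ZMod (5 ^ (m + 1)))) = 1 := by
    intro g
    apply eq_one_of_pow_four_eq_one m _ _ (hdet4 g)
    -- reduction of `det (s g)` mod `5^m` is `det g = 1`, hence mod `5` it is `1`
    have hm' : f (Matrix.det ((s g : GL (Fin 2) (ZMod (5 ^ (m + 1)))) : Matrix (Fin 2) (Fin 2) (ZMod (5 ^ (m + 1))))) = 1 := by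
      rw [RingHom.map_det, hred g, g.prop]
    have hz : f (Matrix.det ((s g : GL (Fin 2) (ZMod (5 ^ (m + 1)))) : Matrix (Fin 2) (Fin 2) (ZMod (5 ^ (m + 1)))) - 1) = 0 := by
      rw [map_sub, hm', map_one, sub_self]
    obtain ⟨t, ht⟩ := exists_eq_mul_of_cast_eq_zero _ _ hz
    rw [sub_eq_iff_eq_add] at ht
    rw [ht, map_add, map_one, map_mul, map_natCast, (ZMod.natCast_eq_zero_iff _ _).2
      (dvd_pow_self 5 (by omega)), zero_mul, zero_add]
  -- so `s` is a section of `SL₂(ℤ/5^{m+1}) → SL₂(ℤ/5^m)`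
  let s' : Matrix.SpecialLinearGroup (Fin 2) (ZMod (5 ^ m)) →* Matrix.SpecialLinearGroup (Fin 2) (ZMod (5 ^ (m + 1))) :=
    { toFun := fun g => ⟨((s g : GL (Fin 2) (ZMod (5 ^ (m + 1)))) : Matrix (Fin 2) (Fin 2) (ZMod (5 ^ (m + 1)))), hdet g⟩
      map_one' := by apply Subtype.ext; simp
      map_mul' := fun x y => by apply Subtype.ext; simp [Units.val_mul] }
  refine not_exists_section_SL2 m hm ⟨s', fun g => ?_⟩
  apply Subtype.ext
  rw [Matrix.SpecialLinearGroup.map_apply_coe]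
  exact hred g



section schur

variable {F : Type*} [Field F]

/-- **Schur for the adjoint module `𝔰𝔩₂` (characteristic `≠ 2`).** A linear endomorphism of the
`2 × 2` matrices that preserves trace zero and commutes, on trace-zero matrices, with conjugation by
the elementary transvections `u = (1 1; 0 1)` and `v = (1 0; 1 1)` acts on `𝔰𝔩₂` as a scalar
(`End_{SL₂}(𝔰𝔩₂) = F`: absolute irreducibility). Proof: `Ad(u) E = E` forces `ψ E ∈ F·E`,
`Ad(v) F' = F'` forces `ψ F' ∈ F·F'`, and `Ad(u) H = H − 2E`, `Ad(v) H = H + 2F'` give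
`ψ H = λ H` and `λ = μ`. -/
theorem exists_eq_smul_of_commute_transvections (h2 : (2 : F) ≠ 0)
    (ψ : Matrix (Fin 2) (Fin 2) F →ₗ[F] Matrix (Fin 2) (Fin 2) F)
    (htr : ∀ X : Matrix (Fin 2) (Fin 2) F, Matrix.trace X = 0 → Matrix.trace (ψ X) = 0)
    (hu : ∀ X : Matrix (Fin 2) (Fin 2) F, Matrix.trace X = 0 →
      ψ (!![1, 1; 0, 1] * X * !![1, -1; 0, 1]) = !![1, 1; 0, 1] * ψ X * !![1, -1; 0, 1])
    (hv : ∀ X : Matrix (Fin 2) (Fin 2) F, Matrix.trace X = 0 →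
      ψ (!![1, 0; 1, 1] * X * !![1, 0; -1, 1]) = !![1, 0; 1, 1] * ψ X * !![1, 0; -1, 1]) :
    ∃ c : F, ∀ X : Matrix (Fin 2) (Fin 2) F, Matrix.trace X = 0 → ψ X = c • X := by
  have two_mul_eq_zero : ∀ x : F, 2 * x = 0 → x = 0 := fun x hx => (mul_eq_zero.1 hx).resolve_left h2
  -- the standard basis of `𝔰𝔩₂`
  have trE : Matrix.trace (!![0, 1; 0, 0] : Matrix (Fin 2) (Fin 2) F) = 0 := by simp [Matrix.trace_fin_two]
  have trF : Matrix.trace (!![0, 0; 1, 0] : Matrix (Fin 2) (Fin 2) F) = 0 := by simp [Matrix.trace_fin_two]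
  have trH : Matrix.trace (!![1, 0; 0, -1] : Matrix (Fin 2) (Fin 2) F) = 0 := by simp [Matrix.trace_fin_two]
  -- conjugation formulas on trace-zero literals
  have Du_formula : ∀ a b c : F, (!![1, 1; 0, 1] * !![a, b; c, -a] * !![1, -1; 0, 1]
      : Matrix (Fin 2) (Fin 2) F) = !![a + c, b - 2 * a - c; c, -a - c] := by
    intro a b c
    simp only [Matrix.mul_fin_two]
    ext i j
    fin_cases i <;> fin_cases j <;> simp
    all_goals ring
  have Dv_formula : ∀ a b c : F, (!![1, 0; 1, 1] * !![a, b; c, -a] * !![1, 0; -1, 1]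
      : Matrix (Fin 2) (Fin 2) F) = !![a - b, b; 2 * a - b + c, b - a] := by
    intro a b c
    simp only [Matrix.mul_fin_two]
    ext i j
    fin_cases i <;> fin_cases j <;> simp
    all_goals ring
  -- the images of `u`, `v` on the basis
  have AduE : (!![1, 1; 0, 1] * !![0, 1; 0, 0] * !![1, -1; 0, 1] : Matrix (Fin 2) (Fin 2) F) = !![0, 1; 0, 0] := by
    rw [show (!![0, 1; 0, 0] : Matrix (Fin 2) (Fin 2) F) = !![0, 1; 0, -0] by rw [neg_zero], Du_formula]
    ext i j; fin_cases i <;> fin_cases j <;> simp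
  have AdvF : (!![1, 0; 1, 1] * !![0, 0; 1, 0] * !![1, 0; -1, 1] : Matrix (Fin 2) (Fin 2) F) = !![0, 0; 1, 0] := by
    rw [show (!![0, 0; 1, 0] : Matrix (Fin 2) (Fin 2) F) = !![0, 0; 1, -0] by rw [neg_zero], Dv_formula]
    ext i j; fin_cases i <;> fin_cases j <;> simp
  have AduH : (!![1, 1; 0, 1] * !![1, 0; 0, -1] * !![1, -1; 0, 1] : Matrix (Fin 2) (Fin 2) F) =
      !![1, 0; 0, -1] - (2 : F) • !![0, 1; 0, 0] := by
    rw [Du_formula]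
    ext i j; fin_cases i <;> fin_cases j <;> simp
  have AdvH : (!![1, 0; 1, 1] * !![1, 0; 0, -1] * !![1, 0; -1, 1] : Matrix (Fin 2) (Fin 2) F) =
      !![1, 0; 0, -1] + (2 : F) • !![0, 0; 1, 0] := by
    rw [Dv_formula]
    ext i j; fin_cases i <;> fin_cases j <;> simp
  -- trace-zero matrices in coordinates
  have coords : ∀ Y : Matrix (Fin 2) (Fin 2) F, Matrix.trace Y = 0 →
      Y = !![Y 0 0, Y 0 1; Y 1 0, -Y 0 0] := by
    intro Y hY
    have hY11 : Y 1 1 = -Y 0 0 := by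
      rw [Matrix.trace_fin_two] at hY; linear_combination hY
    rw [← hY11]; exact Matrix.eta_fin_two Y
  set pE := ψ !![0, 1; 0, 0] with hpE
  set pF := ψ !![0, 0; 1, 0] with hpF
  set pH := ψ !![1, 0; 0, -1] with hpH
  have cE := coords pE (htr _ trE)
  have cF := coords pF (htr _ trF)
  have cH := coords pH (htr _ trH)
  -- (1) `ψ E = λ E`
  have huE := hu !![0, 1; 0, 0] trE
  rw [AduE, ← hpE] at huE
  conv_rhs at huE => rw [cE, Du_formula]
  conv_lhs at huE => rw [cE]
  have eE00 : pE 0 0 = pE 0 0 + pE 1 0 := by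
    have h := congrFun (congrFun huE 0) 0; simpa using h
  have eE01 : pE 0 1 = pE 0 1 - 2 * pE 0 0 - pE 1 0 := by
    have h := congrFun (congrFun huE 0) 1; simpa using h
  have hE10 : pE 1 0 = 0 := by linear_combination -eE00
  have hE00 : pE 0 0 = 0 := two_mul_eq_zero _ (by linear_combination eE01 - hE10)
  -- (2) `ψ F' = μ F'`
  have hvF := hv !![0, 0; 1, 0] trF
  rw [AdvF, ← hpF] at hvF
  conv_rhs at hvF => rw [cF, Dv_formula]
  conv_lhs at hvF => rw [cF]
  have eF00 : pF 0 0 = pF 0 0 - pF 0 1 := by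
    have h := congrFun (congrFun hvF 0) 0; simpa using h
  have eF10 : pF 1 0 = 2 * pF 0 0 - pF 0 1 + pF 1 0 := by
    have h := congrFun (congrFun hvF 1) 0; simpa using h
  have hF01 : pF 0 1 = 0 := by linear_combination eF00
  have hF00 : pF 0 0 = 0 := two_mul_eq_zero _ (by linear_combination -eF10 + hF01)
  -- (3) `ψ H = λ H` and `λ = μ`
  have huH := hu !![1, 0; 0, -1] trH
  rw [AduH, map_sub, map_smul, ← hpH, ← hpE] at huH
  conv_rhs at huH => rw [cH, Du_formula]
  conv_lhs at huH => rw [cH, cE]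
  have eH00 : pH 0 0 - 2 * pE 0 0 = pH 0 0 + pH 1 0 := by
    have h := congrFun (congrFun huH 0) 0; simpa using h
  have eH01 : pH 0 1 - 2 * pE 0 1 = pH 0 1 - 2 * pH 0 0 - pH 1 0 := by
    have h := congrFun (congrFun huH 0) 1; simpa using h
  have hH10 : pH 1 0 = 0 := by linear_combination -eH00 - 2 * hE00
  have hH00 : pH 0 0 = pE 0 1 := by
    have h' := two_mul_eq_zero (pH 0 0 - pE 0 1) (by linear_combination eH01 - hH10)
    exact sub_eq_zero.1 h'
  have hvH := hv !![1, 0; 0, -1] trH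
  rw [AdvH, map_add, map_smul, ← hpH, ← hpF] at hvH
  conv_rhs at hvH => rw [cH, Dv_formula]
  conv_lhs at hvH => rw [cH, cF]
  have eV00 : pH 0 0 + 2 * pF 0 0 = pH 0 0 - pH 0 1 := by
    have h := congrFun (congrFun hvH 0) 0; simpa using h
  have eV10 : pH 1 0 + 2 * pF 1 0 = 2 * pH 0 0 - pH 0 1 + pH 1 0 := by
    have h := congrFun (congrFun hvH 1) 0; simpa using h
  have hH01 : pH 0 1 = 0 := by linear_combination eV00 - 2 * hF00
  have hFE : pF 1 0 = pE 0 1 := by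
    have h' := two_mul_eq_zero (pF 1 0 - pH 0 0) (by linear_combination eV10 - hH01)
    rw [sub_eq_zero] at h'; rw [h', hH00]
  -- (4) conclusion with `c = λ = (ψ E)₀₁`
  refine ⟨pE 0 1, fun X hX => ?_⟩
  have hXd : X = X 0 0 • !![1, 0; 0, -1] + X 0 1 • !![0, 1; 0, 0] + X 1 0 • !![0, 0; 1, 0] := by
    conv_lhs => rw [coords X hX]
    ext i j; fin_cases i <;> fin_cases j <;> simp
  rw [hXd, map_add, map_add, map_smul, map_smul, map_smul, ← hpH, ← hpE, ← hpF, cH, cE, cF,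
    hE00, hE10, hF00, hF01, hH00, hH01, hH10, hFE]
  ext i j; fin_cases i <;> fin_cases j <;> simp <;> ring

end schur

end Summit.BirchSwinnertonDyer.BirchSwinnertonDyer.Theorems.GL2F5AdjointBricks
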